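import Summits.AtomisticToContinuum.Crystallization.Theorems.ChartedZeroExcessLayeredLatticeLiouvilleVA

/-!
# Zero-excess layered lattice Liouville — part VB (lens-2 g57, node «PoincareZ» 2/2): the discrete POINCARÉ inequality on index balls;
Caccioppoli in pure energy form.

`poincare_idxBallF` (configuration-free, chart-free, hypothesis-free): for every centre `x₀`, radius `n` and lattice field `φ`,
`Σ_{X ∈ idxBall x₀ n} ‖φ_X − mean‖² ≤ 288 · n² · idxEnergy φ (idxBall x₀ n)`
([giaquinta1984 Ch. III §1] for the lattice: pair variance `Σ_{X,Y} ‖φ_Y − φ_X‖²` regrouped by the displacement `u = Y − X` into the localised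
increments `dispSqOn u` of part VA, each `≤ 36 R² · idxEnergy` by the three axis legs and the telescoped Cauchy–Schwarz bound, `#{u} ≤ (4R+1)³ ≤
8·#ball`, and Jensen).  With part UZ: `caccioppoli_energy` — `κ₀ · idxEnergy φ (idxBall x₀ r) ≤ 54·F(c)·288·(n + ϱ/c)²/(n − r)² · idxEnergy φ
(idxBall x₀ (n + ϱ/c))` for `ϱ`-truncated-harmonic `φ` on `idxBall x₀ n` in a globally stable laminate.  Bricks of (LD) `LinearExcessDecayZ`;
nothing of the column is re-typed, nothing here is an item.
-/

noncomputable section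

open scoped BigOperators InnerProductSpace RealInnerProductSpace
open MeasureTheory Set Metric Filter Topology
open Summit.AtomisticToContinuum.Crystallization.Theorems.ChartedPlanarOrderRigidityDoor (E3 IsNash atomsIn)
open Summit.AtomisticToContinuum.Crystallization.Theorems.ChartedPlanarOrderDensityDichotomy (μS IsSep nK nK_nonneg)
open Summit.AtomisticToContinuum.Crystallization.Theorems.ChartedPlanarOrderDoorLayered (Layered layeredHom_eq_layered)

namespace Summit.AtomisticToContinuum.Crystallization.Theorems.ChartedZeroExcessLayeredLatticeLiouville

section PoincareBall

variable {c : ℝ} {a b : E3} {w : ℤ → E3}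

/-! ### VB.1  Pair variance, regrouped by displacement -/

/-- the PAIR VARIANCE `Σ_{(X, Y) ∈ Q × Q} ‖φ Y − φ X‖²`. [this file, g57] -/
def pairVar (Q : Finset (Cell 2 × ℤ)) (φ : Cell 2 → ℤ → E3) : ℝ :=
  ∑ x ∈ Q ×ˢ Q, ‖φ x.2.1 x.2.2 - φ x.1.1 x.1.2‖ ^ 2

/-- Auxiliary step (`pairVar nonneg`). [formal bookkeeping] -/
theorem pairVar_nonneg (Q : Finset (Cell 2 × ℤ)) (φ : Cell 2 → ℤ → E3) : 0 ≤ pairVar Q φ :=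
  Finset.sum_nonneg fun _ _ => sq_nonneg _

/-- Auxiliary step (`pairVar eq sum dispSqOn`). [formal bookkeeping] -/
theorem pairVar_eq_sum_dispSqOn (Q : Finset (Cell 2 × ℤ)) (φ : Cell 2 → ℤ → E3) :
    pairVar Q φ = ∑ u ∈ (Q ×ˢ Q).image (fun x => x.2 - x.1), dispSqOn Q φ u := by
  unfold pairVar
  rw [← Finset.sum_fiberwise_of_maps_to (fun _ hx => Finset.mem_image_of_mem (fun x => x.2 - x.1) hx)]
  refine Finset.sum_congr rfl fun u _ => ?_
  unfold dispSqOn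
  rw [← Finset.sum_filter]
  symm
  refine Finset.sum_nbij' (fun X => ((X, X + u) : (Cell 2 × ℤ) × (Cell 2 × ℤ))) (fun x => x.1) ?_ ?_ ?_ ?_ ?_
  · intro X hX
    obtain ⟨hXQ, hXu⟩ := Finset.mem_filter.mp (Finset.mem_coe.mp hX)
    exact Finset.mem_coe.mpr (Finset.mem_filter.mpr ⟨Finset.mem_product.mpr ⟨hXQ, hXu⟩, add_sub_cancel_left X u⟩)
  · intro x hx
    obtain ⟨hxQ, hxu⟩ := Finset.mem_filter.mp (Finset.mem_coe.mp hx)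
    obtain ⟨h1, h2⟩ := Finset.mem_product.mp hxQ
    refine Finset.mem_coe.mpr (Finset.mem_filter.mpr ⟨h1, ?_⟩)
    rw [← hxu, add_sub_cancel]
    exact h2
  · intro X _
    rfl
  · intro x hx
    obtain ⟨_, hxu⟩ := Finset.mem_filter.mp (Finset.mem_coe.mp hx)
    exact Prod.ext rfl (by rw [← hxu, add_sub_cancel])
  · intro X _
    rfl

/-! ### VB.2  Geometry of the index ball: diameter and cardinality -/

/-- Auxiliary step (`idxNorm sub le add`). [formal bookkeeping] -/
theorem idxNorm_sub_le_add (x₀ X Y : Cell 2 × ℤ) : idxNorm (Y - X) ≤ idxNorm (Y - x₀) + idxNorm (X - x₀) := by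
  have h : (idxNorm (Y - X) : ℝ) ≤ (idxNorm (Y - x₀) : ℝ) + (idxNorm (X - x₀) : ℝ) := by
    have h1 := dist_triangle X x₀ Y
    rw [dist_eq_idxNorm X Y, dist_comm X x₀, dist_eq_idxNorm x₀ X, dist_eq_idxNorm x₀ Y] at h1
    linarith
  exact_mod_cast h

/-- Auxiliary step (`idxNorm le floor of mem`). [formal bookkeeping] -/
theorem idxNorm_le_floor_of_mem {x₀ X : Cell 2 × ℤ} {n : ℝ} (hX : X ∈ idxBallF x₀ n) : idxNorm (X - x₀) ≤ ⌊n⌋₊ :=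
  Nat.le_floor (mem_idxBallF_iff_idxNorm.mp hX)

/-- Auxiliary step (`idxNorm le of mem image`). [formal bookkeeping] -/
theorem idxNorm_le_of_mem_image {x₀ : Cell 2 × ℤ} {n : ℝ} {u : Cell 2 × ℤ}
    (hu : u ∈ (idxBallF x₀ n ×ˢ idxBallF x₀ n).image (fun x => x.2 - x.1)) : idxNorm u ≤ 2 * ⌊n⌋₊ := by
  obtain ⟨x, hx, rfl⟩ := Finset.mem_image.mp hu
  obtain ⟨h1, h2⟩ := Finset.mem_product.mp hx
  have := idxNorm_sub_le_add x₀ x.1 x.2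
  have e1 := idxNorm_le_floor_of_mem h1
  have e2 := idxNorm_le_floor_of_mem h2
  omega

/-- Auxiliary step (`idxNorm le of mem idxBox`). [formal bookkeeping] -/
theorem idxNorm_le_of_mem_idxBox {r : ℕ} {v : Cell 2 × ℤ} (hv : v ∈ idxBox r) : idxNorm v ≤ r := by
  obtain ⟨h1, h2⟩ := Finset.mem_product.mp hv
  have h1' := Fintype.mem_piFinset.mp h1
  have key : ∀ z : ℤ, z ∈ Finset.Icc (-(r : ℤ)) r → z.natAbs ≤ r := fun z hz => by
    rw [Finset.mem_Icc] at hz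
    omega
  change max (max _ _) _ ≤ _
  exact max_le (max_le (key _ (h1' 0)) (key _ (h1' 1))) (key _ h2)

/-- Auxiliary step (`card image sub le`). [formal bookkeeping] -/
theorem card_image_sub_le (x₀ : Cell 2 × ℤ) (n : ℝ) :
    ((idxBallF x₀ n ×ˢ idxBallF x₀ n).image (fun x => x.2 - x.1)).card ≤ (4 * ⌊n⌋₊ + 1) ^ 3 := by
  have hsub : (idxBallF x₀ n ×ˢ idxBallF x₀ n).image (fun x => x.2 - x.1) ⊆ idxBox (2 * ⌊n⌋₊) := fun u hu =>
    mem_idxBox (idxNorm_le_of_mem_image hu)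
  have h := Finset.card_le_card hsub
  rw [card_idxBox] at h
  have e : 2 * (2 * ⌊n⌋₊) + 1 = 4 * ⌊n⌋₊ + 1 := by ring
  rwa [e] at h

/-- Auxiliary step (`le card idxBallF`). [formal bookkeeping] -/
theorem le_card_idxBallF (x₀ : Cell 2 × ℤ) {n : ℝ} (hn : 0 ≤ n) : (2 * ⌊n⌋₊ + 1) ^ 3 ≤ (idxBallF x₀ n).card := by
  rw [← card_idxBox ⌊n⌋₊]
  refine Finset.card_le_card_of_injOn (fun v => x₀ + v) (fun v hv => ?_) ((add_right_injective x₀).injOn)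
  have hv' := idxNorm_le_of_mem_idxBox (Finset.mem_coe.mp hv)
  refine Finset.mem_coe.mpr (mem_idxBallF_iff_idxNorm.mpr ?_)
  rw [add_sub_cancel_left]
  calc (idxNorm v : ℝ) ≤ ⌊n⌋₊ := by exact_mod_cast hv'
    _ ≤ n := Nat.floor_le hn

/-! ### VB.3  Each displacement increment is `≤ 36 R² · idxEnergy` -/

/-- Auxiliary step (`dispSqOn le of idxNorm le`). [formal bookkeeping] -/
theorem dispSqOn_le_of_idxNorm_le (x₀ : Cell 2 × ℤ) (n : ℝ) (φ : Cell 2 → ℤ → E3) {u : Cell 2 × ℤ} {R : ℕ}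
    (hu : idxNorm u ≤ 2 * R) : dispSqOn (idxBallF x₀ n) φ u ≤ 36 * (R : ℝ) ^ 2 * idxEnergy φ (idxBall x₀ n) := by
  have hE := dispSqOn_axes_le (idxBallF x₀ n) φ
  rw [coe_idxBallF] at hE
  have hE0 := idxEnergy_nonneg φ (idxBall x₀ n)
  have l1 := dispSqOn_zsmul_le x₀ n φ idxAxis₁ (u.1 0)
  have l2 := dispSqOn_zsmul_le x₀ n φ idxAxis₂ (u.1 1)
  have l3 := dispSqOn_zsmul_le x₀ n φ idxAxis₃ u.2
  have s1 : ((u.1 0 : ℤ) : ℝ) ^ 2 ≤ (2 * (R : ℝ)) ^ 2 := by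
    have := sq_cast_le_of_natAbs_le ((natAbs_fst_le_idxNorm u 0).trans hu); push_cast at this; exact this
  have s2 : ((u.1 1 : ℤ) : ℝ) ^ 2 ≤ (2 * (R : ℝ)) ^ 2 := by
    have := sq_cast_le_of_natAbs_le ((natAbs_fst_le_idxNorm u 1).trans hu); push_cast at this; exact this
  have s3 : ((u.2 : ℤ) : ℝ) ^ 2 ≤ (2 * (R : ℝ)) ^ 2 := by
    have := sq_cast_le_of_natAbs_le ((natAbs_snd_le_idxNorm u).trans hu); push_cast at this; exact this
  have d1 := dispSqOn_nonneg (idxBallF x₀ n) φ idxAxis₁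
  have d2 := dispSqOn_nonneg (idxBallF x₀ n) φ idxAxis₂
  have d3 := dispSqOn_nonneg (idxBallF x₀ n) φ idxAxis₃
  calc dispSqOn (idxBallF x₀ n) φ u
      ≤ 3 * (dispSqOn (idxBallF x₀ n) φ (u.1 0 • idxAxis₁) + dispSqOn (idxBallF x₀ n) φ (u.1 1 • idxAxis₂) +
          dispSqOn (idxBallF x₀ n) φ (u.2 • idxAxis₃)) := dispSqOn_le_three_legs x₀ n φ u
    _ ≤ 3 * ((2 * (R : ℝ)) ^ 2 * dispSqOn (idxBallF x₀ n) φ idxAxis₁ + (2 * (R : ℝ)) ^ 2 * dispSqOn (idxBallF x₀ n) φ idxAxis₂ +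
          (2 * (R : ℝ)) ^ 2 * dispSqOn (idxBallF x₀ n) φ idxAxis₃) := by
        gcongr
        exacts [l1.trans (mul_le_mul_of_nonneg_right s1 d1), l2.trans (mul_le_mul_of_nonneg_right s2 d2),
          l3.trans (mul_le_mul_of_nonneg_right s3 d3)]
    _ = 12 * (R : ℝ) ^ 2 * (dispSqOn (idxBallF x₀ n) φ idxAxis₁ + dispSqOn (idxBallF x₀ n) φ idxAxis₂ +
          dispSqOn (idxBallF x₀ n) φ idxAxis₃) := by ring
    _ ≤ 12 * (R : ℝ) ^ 2 * (3 * idxEnergy φ (idxBall x₀ n)) := mul_le_mul_of_nonneg_left hE (by positivity)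
    _ = 36 * (R : ℝ) ^ 2 * idxEnergy φ (idxBall x₀ n) := by ring

/-- Auxiliary step (`pairVar idxBallF le`). [formal bookkeeping] -/
theorem pairVar_idxBallF_le (x₀ : Cell 2 × ℤ) (n : ℝ) (φ : Cell 2 → ℤ → E3) :
    pairVar (idxBallF x₀ n) φ ≤ (((4 * ⌊n⌋₊ + 1) ^ 3 : ℕ) : ℝ) * (36 * (⌊n⌋₊ : ℝ) ^ 2 * idxEnergy φ (idxBall x₀ n)) := by
  have hE0 := idxEnergy_nonneg φ (idxBall x₀ n)
  rw [pairVar_eq_sum_dispSqOn]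
  calc ∑ u ∈ (idxBallF x₀ n ×ˢ idxBallF x₀ n).image (fun x => x.2 - x.1), dispSqOn (idxBallF x₀ n) φ u
      ≤ ∑ u ∈ (idxBallF x₀ n ×ˢ idxBallF x₀ n).image (fun x => x.2 - x.1), 36 * (⌊n⌋₊ : ℝ) ^ 2 * idxEnergy φ (idxBall x₀ n) :=
        Finset.sum_le_sum fun u hu => dispSqOn_le_of_idxNorm_le x₀ n φ (idxNorm_le_of_mem_image hu)
    _ = (((idxBallF x₀ n ×ˢ idxBallF x₀ n).image (fun x => x.2 - x.1)).card : ℝ) *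
          (36 * (⌊n⌋₊ : ℝ) ^ 2 * idxEnergy φ (idxBall x₀ n)) := by rw [Finset.sum_const, nsmul_eq_mul]
    _ ≤ (((4 * ⌊n⌋₊ + 1) ^ 3 : ℕ) : ℝ) * (36 * (⌊n⌋₊ : ℝ) ^ 2 * idxEnergy φ (idxBall x₀ n)) :=
        mul_le_mul_of_nonneg_right (by exact_mod_cast card_image_sub_le x₀ n) (by positivity)

/-! ### VB.4  Jensen and the Poincaré inequality -/

/-- the MEAN of a lattice field over a finite index set. [this file, g57] -/
def idxMean (Q : Finset (Cell 2 × ℤ)) (φ : Cell 2 → ℤ → E3) : E3 :=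
  ((Q.card : ℝ))⁻¹ • ∑ Y ∈ Q, φ Y.1 Y.2

/-- JENSEN: `‖φ_X − mean‖² ≤ (#Q)⁻¹ · Σ_{Y ∈ Q} ‖φ_Y − φ_X‖²`. [this file, g57] -/
theorem norm_sub_idxMean_sq_le {Q : Finset (Cell 2 × ℤ)} (φ : Cell 2 → ℤ → E3) {X : Cell 2 × ℤ} (hX : X ∈ Q) :
    ‖φ X.1 X.2 - idxMean Q φ‖ ^ 2 ≤ ((Q.card : ℝ))⁻¹ * ∑ Y ∈ Q, ‖φ Y.1 Y.2 - φ X.1 X.2‖ ^ 2 := by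
  have hm : (0 : ℝ) < Q.card := by exact_mod_cast Finset.card_pos.mpr ⟨X, hX⟩
  have hrep : φ X.1 X.2 - idxMean Q φ = ((Q.card : ℝ))⁻¹ • ∑ Y ∈ Q, (φ X.1 X.2 - φ Y.1 Y.2) := by
    unfold idxMean
    rw [Finset.sum_sub_distrib, Finset.sum_const, ← Nat.cast_smul_eq_nsmul ℝ, smul_sub, smul_smul,
      inv_mul_cancel₀ hm.ne', one_smul]
  have hS : ∑ Y ∈ Q, ‖φ X.1 X.2 - φ Y.1 Y.2‖ ^ 2 = ∑ Y ∈ Q, ‖φ Y.1 Y.2 - φ X.1 X.2‖ ^ 2 :=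
    Finset.sum_congr rfl fun Y _ => by rw [norm_sub_rev]
  rw [hrep, norm_smul, norm_inv, Real.norm_natCast, mul_pow, ← hS]
  calc ((Q.card : ℝ))⁻¹ ^ 2 * ‖∑ Y ∈ Q, (φ X.1 X.2 - φ Y.1 Y.2)‖ ^ 2
      ≤ ((Q.card : ℝ))⁻¹ ^ 2 * (∑ Y ∈ Q, ‖φ X.1 X.2 - φ Y.1 Y.2‖) ^ 2 := by
        gcongr
        exact norm_sum_le _ _
    _ ≤ ((Q.card : ℝ))⁻¹ ^ 2 * (Q.card * ∑ Y ∈ Q, ‖φ X.1 X.2 - φ Y.1 Y.2‖ ^ 2) := by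
        gcongr
        exact sq_sum_le_card_mul_sum_sq
    _ = ((Q.card : ℝ))⁻¹ * ∑ Y ∈ Q, ‖φ X.1 X.2 - φ Y.1 Y.2‖ ^ 2 := by
        field_simp

/-- ★★ DISCRETE POINCARÉ INEQUALITY on index balls (hypothesis-free):
`Σ_{X ∈ idxBall x₀ n} ‖φ_X − mean‖² ≤ 288 · n² · idxEnergy φ (idxBall x₀ n)`. [giaquinta1984 Ch. III §1; folklore; this file, g57] -/
theorem poincare_idxBallF (x₀ : Cell 2 × ℤ) (n : ℝ) (φ : Cell 2 → ℤ → E3) :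
    ∑ X ∈ idxBallF x₀ n, ‖φ X.1 X.2 - idxMean (idxBallF x₀ n) φ‖ ^ 2 ≤ 288 * n ^ 2 * idxEnergy φ (idxBall x₀ n) := by
  have hE0 := idxEnergy_nonneg φ (idxBall x₀ n)
  rcases lt_or_ge n 0 with hn | hn
  · rw [idxBallF_eq_empty hn, Finset.sum_empty]
    positivity
  have hm : (0 : ℝ) < (idxBallF x₀ n).card := by
    have hx₀ : x₀ ∈ idxBallF x₀ n := mem_idxBallF.mpr (by rw [dist_self]; exact hn)
    exact_mod_cast Finset.card_pos.mpr ⟨x₀, hx₀⟩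
  have hR : (⌊n⌋₊ : ℝ) ≤ n := Nat.floor_le hn
  have hJ : ∑ X ∈ idxBallF x₀ n, ‖φ X.1 X.2 - idxMean (idxBallF x₀ n) φ‖ ^ 2 ≤
      (((idxBallF x₀ n).card : ℝ))⁻¹ * pairVar (idxBallF x₀ n) φ := by
    calc ∑ X ∈ idxBallF x₀ n, ‖φ X.1 X.2 - idxMean (idxBallF x₀ n) φ‖ ^ 2
        ≤ ∑ X ∈ idxBallF x₀ n, (((idxBallF x₀ n).card : ℝ))⁻¹ * ∑ Y ∈ idxBallF x₀ n, ‖φ Y.1 Y.2 - φ X.1 X.2‖ ^ 2 :=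
          Finset.sum_le_sum fun X hX => norm_sub_idxMean_sq_le φ hX
      _ = (((idxBallF x₀ n).card : ℝ))⁻¹ * pairVar (idxBallF x₀ n) φ := by
          rw [← Finset.mul_sum]
          unfold pairVar
          rw [Finset.sum_product]
  have h8 : (((idxBallF x₀ n).card : ℝ))⁻¹ * (((4 * ⌊n⌋₊ + 1) ^ 3 : ℕ) : ℝ) ≤ 8 := by
    rw [inv_mul_le_iff₀ hm]
    have hnat : (4 * ⌊n⌋₊ + 1) ^ 3 ≤ 8 * (2 * ⌊n⌋₊ + 1) ^ 3 := by
      calc (4 * ⌊n⌋₊ + 1) ^ 3 ≤ (4 * ⌊n⌋₊ + 2) ^ 3 := Nat.pow_le_pow_left (by omega) 3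
        _ = 8 * (2 * ⌊n⌋₊ + 1) ^ 3 := by ring
    have hQ := le_card_idxBallF x₀ hn
    calc (((4 * ⌊n⌋₊ + 1) ^ 3 : ℕ) : ℝ) ≤ ((8 * (2 * ⌊n⌋₊ + 1) ^ 3 : ℕ) : ℝ) := by exact_mod_cast hnat
      _ ≤ ((8 * (idxBallF x₀ n).card : ℕ) : ℝ) := by exact_mod_cast Nat.mul_le_mul_left 8 hQ
      _ = ((idxBallF x₀ n).card : ℝ) * 8 := by push_cast; ring
  calc ∑ X ∈ idxBallF x₀ n, ‖φ X.1 X.2 - idxMean (idxBallF x₀ n) φ‖ ^ 2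
      ≤ (((idxBallF x₀ n).card : ℝ))⁻¹ * pairVar (idxBallF x₀ n) φ := hJ
    _ ≤ (((idxBallF x₀ n).card : ℝ))⁻¹ * ((((4 * ⌊n⌋₊ + 1) ^ 3 : ℕ) : ℝ) * (36 * (⌊n⌋₊ : ℝ) ^ 2 * idxEnergy φ (idxBall x₀ n))) :=
        mul_le_mul_of_nonneg_left (pairVar_idxBallF_le x₀ n φ) (by positivity)
    _ = (((idxBallF x₀ n).card : ℝ))⁻¹ * (((4 * ⌊n⌋₊ + 1) ^ 3 : ℕ) : ℝ) * (36 * ((⌊n⌋₊ : ℝ) ^ 2 * idxEnergy φ (idxBall x₀ n))) := by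
        ring
    _ ≤ 8 * (36 * ((n : ℝ) ^ 2 * idxEnergy φ (idxBall x₀ n))) := by
        refine mul_le_mul h8 ?_ (by positivity) (by norm_num)
        refine mul_le_mul_of_nonneg_left (mul_le_mul_of_nonneg_right ?_ hE0) (by norm_num)
        exact pow_le_pow_left₀ (by positivity) hR 2
    _ = 288 * n ^ 2 * idxEnergy φ (idxBall x₀ n) := by ring

/-- the constant-free form: SOME constant `v` achieves the Poincaré bound (as (LD)'s Campanato step will use it). [this file, g57] -/
theorem exists_poincare_idxBallF (x₀ : Cell 2 × ℤ) (n : ℝ) (φ : Cell 2 → ℤ → E3) :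
    ∃ v : E3, ∑ X ∈ idxBallF x₀ n, ‖φ X.1 X.2 - v‖ ^ 2 ≤ 288 * n ^ 2 * idxEnergy φ (idxBall x₀ n) :=
  ⟨idxMean (idxBallF x₀ n) φ, poincare_idxBallF x₀ n φ⟩

/-! ### VB.5  Caccioppoli in pure energy form -/

/-- ★★ ENERGY CACCIOPPOLI (UZ + Poincaré): for every `c > 0`, `κ₀ > 0` there is `ϱ_C ≥ 1` such that for all `ϱ ≥ ϱ_C`, every `κ₀`-coercive
`c`-co-Lipschitz layered crystal, every centre, radii `r < n` and every `φ` that is `ϱ`-truncated-harmonic on `idxBall x₀ n`,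
`κ₀ · idxEnergy φ (idxBall x₀ r) ≤ 54·F(c)·(n − r)⁻²·288·(n + ϱ/c)² · idxEnergy φ (idxBall x₀ (n + ϱ/c))`. [giaquinta1984 Ch. III §2; this file, g57] -/
theorem caccioppoli_energy (hc : 0 < c) {κ₀ : ℝ} (hκ₀ : 0 < κ₀) :
    ∃ ϱC : ℝ, 1 ≤ ϱC ∧ ∀ ϱ : ℝ, ϱC ≤ ϱ → ∀ (a b : E3) (w : ℤ → E3), IsLayeredCrystal c a b w → CoerciveZ (layeredKernel a b w) κ₀ →
      ∀ (x₀ : Cell 2 × ℤ) (r n : ℝ), r < n → ∀ φ : Cell 2 → ℤ → E3, IsTruncHarmonicZ ϱ a b w φ (idxBall x₀ n) →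
        κ₀ * idxEnergy φ (idxBall x₀ r) ≤
          54 * kernelConst c * ((n - r)⁻¹) ^ 2 * (288 * (n + ϱ / c) ^ 2) * idxEnergy φ (idxBall x₀ (n + ϱ / c)) := by
  obtain ⟨ϱC, hϱC, H⟩ := caccioppoli_idxBall hc hκ₀
  refine ⟨ϱC, hϱC, fun ϱ hϱ a b w hL hK x₀ r n hrn φ hφ => ?_⟩
  have hF := kernelConst_nonneg hc
  calc κ₀ * idxEnergy φ (idxBall x₀ r)
      ≤ 54 * kernelConst c * ((n - r)⁻¹) ^ 2 * ∑ X ∈ idxBallF x₀ (n + ϱ / c), ‖φ X.1 X.2 - idxMean (idxBallF x₀ (n + ϱ / c)) φ‖ ^ 2 :=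
        H ϱ hϱ a b w hL hK x₀ r n hrn φ hφ _
    _ ≤ 54 * kernelConst c * ((n - r)⁻¹) ^ 2 * (288 * (n + ϱ / c) ^ 2 * idxEnergy φ (idxBall x₀ (n + ϱ / c))) :=
        mul_le_mul_of_nonneg_left (poincare_idxBallF x₀ (n + ϱ / c) φ) (by positivity)
    _ = _ := by ring

end PoincareBall

end Summit.AtomisticToContinuum.Crystallization.Theorems.ChartedZeroExcessLayeredLatticeLiouville

end
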